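import Mathlib
import Summits.Ventures.PercRepro.PuncturedLYMMixP1Q1Table1
import Summits.Ventures.PercRepro.PuncturedLYMMixP1Q1Pos1

/-!
# PercRepro — (SP) FOR `1` PAIRWISE DISJOINT PAIRS AND `1` PAIRWISE DISJOINT QUADRUPLES AT LEVEL `4`: POSITIVITY BY CLASS (1)
(p10, gen 41)

For each class, every direction's numerator is nonnegative on the class (`split_ifs` over the directions).  Nothing here asserts (SP).
-/

namespace PercRepro.PuncturedLYM.Split.TypeLift.MixP1Q1

/-- The class `(0, 0, 0, 0)`: every direction's numerator is nonnegative for `n ≥ 10`. -/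
theorem sel_0000_nonneg (n : ℚ) (v : ℕ) (hn : 10 ≤ n) : 0 ≤ sel_0000 v n := by
  unfold sel_0000
  split_ifs with h1 h2 h3
  · exact N_0000_D20_nonneg n hn
  · exact N_0000_D40_nonneg n hn
  · exact N_0000_F_nonneg n hn
  · exact le_refl 0

/-- The class `(0, 0, 0, 1)`: every direction's numerator is nonnegative for `n ≥ 7`. -/
theorem sel_0001_nonneg (n : ℚ) (v : ℕ) (hn : 7 ≤ n) : 0 ≤ sel_0001 v n := by
  unfold sel_0001
  split_ifs with h1 h2
  · exact N_0001_D20_nonneg n hn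
  · exact N_0001_F_nonneg n hn
  · exact le_refl 0

/-- The class `(0, 0, 1, 0)`: every direction's numerator is nonnegative for `n ≥ 8`. -/
theorem sel_0010_nonneg (n : ℚ) (v : ℕ) (hn : 8 ≤ n) : 0 ≤ sel_0010 v n := by
  unfold sel_0010
  split_ifs with h1 h2 h3
  · exact N_0010_D20_nonneg n hn
  · exact N_0010_D42_nonneg n hn
  · exact N_0010_F_nonneg n hn
  · exact le_refl 0

/-- The class `(0, 1, 0, 0)`: every direction's numerator is nonnegative for `n ≥ 9`. -/
theorem sel_0100_nonneg (n : ℚ) (v : ℕ) (hn : 9 ≤ n) : 0 ≤ sel_0100 v n := by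
  unfold sel_0100
  split_ifs with h1 h2 h3
  · exact N_0100_D20_nonneg n hn
  · exact N_0100_D41_nonneg n hn
  · exact N_0100_F_nonneg n hn
  · exact le_refl 0

/-- The class `(1, 0, 0, 0)`: every direction's numerator is nonnegative for `n ≥ 9`. -/
theorem sel_1000_nonneg (n : ℚ) (v : ℕ) (hn : 9 ≤ n) : 0 ≤ sel_1000 v n := by
  unfold sel_1000
  split_ifs with h1 h2
  · exact N_1000_D40_nonneg n hn
  · exact N_1000_F_nonneg n hn
  · exact le_refl 0

/-- The class `(1, 0, 0, 1)`: every direction's numerator is nonnegative for `n ≥ 6`. -/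
theorem sel_1001_nonneg (n : ℚ) (v : ℕ) (hn : 6 ≤ n) : 0 ≤ sel_1001 v n := by
  unfold sel_1001
  split_ifs with h1
  · exact N_1001_F_nonneg n hn
  · exact le_refl 0

/-- The class `(1, 0, 1, 0)`: every direction's numerator is nonnegative for `n ≥ 7`. -/
theorem sel_1010_nonneg (n : ℚ) (v : ℕ) (hn : 7 ≤ n) : 0 ≤ sel_1010 v n := by
  unfold sel_1010
  split_ifs with h1 h2
  · exact N_1010_D42_nonneg n hn
  · exact N_1010_F_nonneg n hn
  · exact le_refl 0

/-- The class `(1, 1, 0, 0)`: every direction's numerator is nonnegative for `n ≥ 8`. -/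
theorem sel_1100_nonneg (n : ℚ) (v : ℕ) (hn : 8 ≤ n) : 0 ≤ sel_1100 v n := by
  unfold sel_1100
  split_ifs with h1 h2
  · exact N_1100_D41_nonneg n hn
  · exact N_1100_F_nonneg n hn
  · exact le_refl 0

end PercRepro.PuncturedLYM.Split.TypeLift.MixP1Q1
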